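import Mathlib
import HarnessLib
import Literature.NumberTheory.DiophantineGeometry.ConicLocalDensities

/-!
# Local densities of the primitive points of a diagonal conic, II: the global weight

Continues `ConicLocalDensities.lean`. With `M = ∏_{p ∣ 2abc} p²` and the global weight
`W(ξ) = ∏_{p ∣ 2abc} localWeight_p(ξ)` of a class `ξ ∈ (ℤ/M)²`:

* `localWeight_facts_b`, `localWeight_facts_c`, `localWeight_facts_two` — the meaning of the local
  weight at primes `p ∣ b`, `p ∣ c`, `p = 2 ∤ abc`; `sum_localWeight_odd` (`= 2p²(p−1)`),
  `sum_localWeight_two` (`= 16`);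
* `globalWeight`, `intWeight`; classes of positive weight are primitive modulo `M`
  (`coprime_of_globalWeight_ne_zero`); **`sum_globalWeight`** — the Chinese remainder
  factorisation `Σ_ξ W(ξ) = ∏_p Σ_η localWeight_p(η)` (Mathlib's `ZMod.prodEquivPi`) and its value
  `16 ∏_{odd p ∣ abc} 2p²(p−1)` (`sum_globalWeight_eq`);
* **`intWeight_facts`** — for a primitive `v` of positive weight, `W ∣ g(v)` and
  `a ∣ X/g`, `b ∣ Y/g`, `c ∣ Z/g` (under the `2`-adic solubility conditions).

These are the ingredients of the main term `c_{H_y}(C_y(𝔸)^+)` of the conic count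
(Browning–Van Valckenborgh 2012, §2.4, §3). Everything is proved.

## References

* T. D. Browning, K. Van Valckenborgh, *Sums of three squareful numbers*, Exp. Math. 21 (2012)
  204–211, §2.2–2.4, §3. [cite: BrowningValckenborgh2012, §2.4, §3]
-/

namespace Literature.NumberTheory.DiophantineGeometry


section LocalWeightFacts2

open Finset

variable {a b c : ℕ} {P e₁ e₂ : ℤ × ℤ × ℤ}

/-- **(G1) at a prime `p ∣ b`** (chart `2`, coordinates swapped): `w = 1 ⟹ p ∤ X₂ ∧ p ∣ X₁`;
`w = p ⟹ p ∣ X₀, X₁, X₂ ∧ p² ∤ X₀ ∧ p² ∣ X₁`. (At `p = 2`: `8 ∣ a − c` assumed.) [folklore] -/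
theorem localWeight_facts_b (hd : Squarefree (a * b * c)) (hP : ternForm (coeffs a b c) P = 0)
    (hPc : content3 P = 1) (he : idet3 P e₁ e₂ = 1) {p : ℕ} (hp : p.Prime) (hpb : p ∣ b)
    (h8 : p = 2 → (8 : ℤ) ∣ (a : ℤ) - c) {v : ℤ × ℤ} (hv : Int.gcd v.1 v.2 = 1) :
    (localWeight a b c P e₁ e₂ p ((v.1 : ZMod (p ^ 2)), (v.2 : ZMod (p ^ 2))) = 1 →
      ¬(p : ℤ) ∣ (conicMap (coeffs a b c) P (v.1 • e₁ + v.2 • e₂)).2.2 ∧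
        (p : ℤ) ∣ (conicMap (coeffs a b c) P (v.1 • e₁ + v.2 • e₂)).2.1) ∧
    (localWeight a b c P e₁ e₂ p ((v.1 : ZMod (p ^ 2)), (v.2 : ZMod (p ^ 2))) = p →
      (p : ℤ) ∣ (conicMap (coeffs a b c) P (v.1 • e₁ + v.2 • e₂)).1 ∧
      (p : ℤ) ∣ (conicMap (coeffs a b c) P (v.1 • e₁ + v.2 • e₂)).2.1 ∧
      (p : ℤ) ∣ (conicMap (coeffs a b c) P (v.1 • e₁ + v.2 • e₂)).2.2 ∧
      ¬((p : ℤ) ^ 2 ∣ (conicMap (coeffs a b c) P (v.1 • e₁ + v.2 • e₂)).1) ∧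
      (p : ℤ) ^ 2 ∣ (conicMap (coeffs a b c) P (v.1 • e₁ + v.2 • e₂)).2.1) := by
  -- units, through the swap `0 ↔ 1`
  have hd' : Squarefree (b * a * c) := by rwa [mul_comm b a]
  have hcoe : coeffs b a c = swap01 (coeffs a b c) := rfl
  have hP' : ternForm (coeffs b a c) (swap01 P) = 0 := by rw [hcoe, ternForm_swap01]; exact hP
  have hPc' : content3 (swap01 P) = 1 := by rw [content3_swap01]; exact hPc
  obtain ⟨ha, _, hb2, hα, hγ⟩ := units_of_dvd_fst hd' hP' hPc' hp hpb
  simp only [swap01] at hα hγ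
  have hpa : ¬p ∣ a := fun h => ha (Int.natCast_dvd_natCast.2 h)
  have hpb' : (p : ℤ) ∣ (b : ℤ) := Int.natCast_dvd_natCast.2 hpb
  haveI : NeZero (p ^ 2) := ⟨pow_ne_zero 2 hp.ne_zero⟩
  have hγu : IsUnit (P.2.2 : ZMod (p ^ 2)) := isUnit_intCast_sq_of_not_dvd hp hγ
  set u := v.1 • e₁ + v.2 • e₂ with hu
  obtain ⟨k, hk, h0, h1, h2⟩ := chart2_reduction hP (coprime_natAbs_sq_of_not_dvd hp hγ) u
  obtain ⟨hdp, hdp2⟩ := natCast_pow_two_dvd p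
  set s' := u.1 - k * P.1 with hs'
  set t' := u.2.1 - k * P.2.1 with ht'
  have hT : ((s' : ZMod (p ^ 2)), (t' : ZMod (p ^ 2))) =
      transfer2 P e₁ e₂ (p ^ 2) ((v.1 : ZMod (p ^ 2)), (v.2 : ZMod (p ^ 2))) :=
    transfer2_intCast hγu v hk
  have hst : ¬((p : ℤ) ∣ t' ∧ (p : ℤ) ∣ s') := by
    rintro ⟨h2', h1'⟩
    obtain ⟨d1, d2⟩ := dvd_of_chart2_dvd he v (hdp.trans hk) h1' h2'
    have : p ∣ Int.gcd v.1 v.2 := Int.dvd_gcd d1 d2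
    rw [hv] at this
    exact hp.ne_one (Nat.dvd_one.1 this)
  -- the swapped chart point
  have hx : conicMap (swap01 (coeffs a b c)) (swap01 P) (t', s', 0) =
      swap01 (conicMap (coeffs a b c) P (s', t', 0)) := by
    have := conicMap_swap01 (coeffs a b c) P (s', t', 0)
    simpa [swap01] using this
  unfold localWeight
  rw [if_neg hpa, if_pos hpb]
  by_cases hp2 : p = 2
  · subst hp2
    rw [if_pos rfl, ← hT, Prod.swap_prod_mk]
    have h4 : ¬(4 : ℤ) ∣ (b : ℤ) := by simpa using hb2
    have h2b : (2 : ℤ) ∣ ((swap01 (coeffs a b c)).1) := hpb'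
    have hA1 : ¬(2 : ℤ) ∣ (swap01 (coeffs a b c)).2.1 := by simpa [swap01, coeffs] using ha
    have hA2 : ¬(2 : ℤ) ∣ (swap01 (coeffs a b c)).2.2 := by
      simpa [swap01, coeffs] using (units_of_dvd_fst hd' hP' hPc' Nat.prime_two hpb).2.1
    have hP'' : ternForm (swap01 (coeffs a b c)) (swap01 P) = 0 := by rw [ternForm_swap01]; exact hP
    have hβ' : (2 : ℤ) ∣ (swap01 P).1 :=
      (two_dvd_fst_iff_eight_dvd (A := swap01 (coeffs a b c)) (P := swap01 P) h2b
        (by simpa [swap01, coeffs] using h4) hA1 hA2 (by simpa [swap01] using hα)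
        (by simpa [swap01] using hγ) hP'').2 (by simpa [swap01, coeffs, sub_eq_add_neg] using h8 rfl)
    obtain ⟨f1, f2⟩ := wTwoA_facts (A := swap01 (coeffs a b c)) (P := swap01 P) h2b
      (by simpa [swap01, coeffs] using h4) hA1 (by simpa [swap01] using hα)
      (by simpa [swap01] using hγ) hβ' t' s'
    rw [hx] at f1 f2
    simp only [swap01] at f1 f2
    constructor
    · intro hw
      obtain ⟨g1, g2⟩ := f1 hw
      exact ⟨fun h => g1 ((dvd_iff_of_modEq h2 hdp).1 h), (dvd_iff_of_modEq h1 hdp).2 g2⟩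
    · intro hw
      obtain ⟨g1, g2, g3, g4, g5⟩ := f2 hw
      rw [show (4 : ℤ) = ((2 : ℕ) : ℤ) ^ 2 by norm_num] at g4 g5
      exact ⟨(dvd_iff_of_modEq h0 hdp).2 g2, (dvd_iff_of_modEq h1 hdp).2 g1,
        (dvd_iff_of_modEq h2 hdp).2 g3, fun h => g4 ((dvd_iff_of_modEq h0 hdp2).1 h),
        (dvd_iff_of_modEq h1 hdp2).2 g5⟩
  · rw [if_neg hp2, ← hT, Prod.swap_prod_mk]
    obtain ⟨f1, f2⟩ := wOdd_facts (A := swap01 (coeffs a b c)) (P := swap01 P) hp hpb'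
      hb2 ha (by simpa [swap01] using hα) (by simpa [swap01] using hγ) hst
    rw [hx] at f1 f2
    simp only [swap01] at f1 f2
    constructor
    · intro hw
      obtain ⟨g1, g2⟩ := f1 hw
      exact ⟨fun h => g1 ((dvd_iff_of_modEq h2 hdp).1 h), (dvd_iff_of_modEq h1 hdp).2 g2⟩
    · intro hw
      obtain ⟨g1, g2, g3, g4, g5⟩ := f2 hw
      exact ⟨(dvd_iff_of_modEq h0 hdp).2 g2, (dvd_iff_of_modEq h1 hdp).2 g1,
        (dvd_iff_of_modEq h2 hdp).2 g3, fun h => g4 ((dvd_iff_of_modEq h0 hdp2).1 h),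
        (dvd_iff_of_modEq h1 hdp2).2 g5⟩

/-- **(G1) at a prime `p ∣ c`** (chart `0`): `w = 1 ⟹ p ∤ X₀ ∧ p ∣ X₂`;
`w = p ⟹ p ∣ X₀, X₁, X₂ ∧ p² ∤ X₁ ∧ p² ∣ X₂`. (At `p = 2`: `8 ∣ a + b` assumed.) [folklore] -/
theorem localWeight_facts_c (hd : Squarefree (a * b * c)) (hP : ternForm (coeffs a b c) P = 0)
    (hPc : content3 P = 1) (he : idet3 P e₁ e₂ = 1) {p : ℕ} (hp : p.Prime) (hpc : p ∣ c)
    (h8 : p = 2 → (8 : ℤ) ∣ (a : ℤ) + b) {v : ℤ × ℤ} (hv : Int.gcd v.1 v.2 = 1) :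
    (localWeight a b c P e₁ e₂ p ((v.1 : ZMod (p ^ 2)), (v.2 : ZMod (p ^ 2))) = 1 →
      ¬(p : ℤ) ∣ (conicMap (coeffs a b c) P (v.1 • e₁ + v.2 • e₂)).1 ∧
        (p : ℤ) ∣ (conicMap (coeffs a b c) P (v.1 • e₁ + v.2 • e₂)).2.2) ∧
    (localWeight a b c P e₁ e₂ p ((v.1 : ZMod (p ^ 2)), (v.2 : ZMod (p ^ 2))) = p →
      (p : ℤ) ∣ (conicMap (coeffs a b c) P (v.1 • e₁ + v.2 • e₂)).1 ∧
      (p : ℤ) ∣ (conicMap (coeffs a b c) P (v.1 • e₁ + v.2 • e₂)).2.1 ∧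
      (p : ℤ) ∣ (conicMap (coeffs a b c) P (v.1 • e₁ + v.2 • e₂)).2.2 ∧
      ¬((p : ℤ) ^ 2 ∣ (conicMap (coeffs a b c) P (v.1 • e₁ + v.2 • e₂)).2.1) ∧
      (p : ℤ) ^ 2 ∣ (conicMap (coeffs a b c) P (v.1 • e₁ + v.2 • e₂)).2.2) := by
  obtain ⟨ha, hb, hc2, hα, hβ⟩ := units_of_dvd_thd hd hP hPc hp hpc
  have hpa : ¬p ∣ a := fun h => ha (Int.natCast_dvd_natCast.2 h)
  have hpb : ¬p ∣ b := fun h => hb (Int.natCast_dvd_natCast.2 h)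
  have hpc' : (p : ℤ) ∣ (c : ℤ) := Int.natCast_dvd_natCast.2 hpc
  haveI : NeZero (p ^ 2) := ⟨pow_ne_zero 2 hp.ne_zero⟩
  have hαu : IsUnit (P.1 : ZMod (p ^ 2)) := isUnit_intCast_sq_of_not_dvd hp hα
  set u := v.1 • e₁ + v.2 • e₂ with hu
  obtain ⟨k, hk, h0, h1, h2⟩ := chart0_reduction hP (coprime_natAbs_sq_of_not_dvd hp hα) u
  obtain ⟨hdp, hdp2⟩ := natCast_pow_two_dvd p
  set s' := u.2.2 - k * P.2.2 with hs'
  set t' := u.2.1 - k * P.2.1 with ht'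
  have hT : ((s' : ZMod (p ^ 2)), (t' : ZMod (p ^ 2))) =
      transfer0 P e₁ e₂ (p ^ 2) ((v.1 : ZMod (p ^ 2)), (v.2 : ZMod (p ^ 2))) :=
    transfer0_intCast hαu v hk
  have hst : ¬((p : ℤ) ∣ s' ∧ (p : ℤ) ∣ t') := by
    rintro ⟨h1', h2'⟩
    obtain ⟨d1, d2⟩ := dvd_of_chart0_dvd he v (hdp.trans hk) h1' h2'
    have : p ∣ Int.gcd v.1 v.2 := Int.dvd_gcd d1 d2
    rw [hv] at this
    exact hp.ne_one (Nat.dvd_one.1 this)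
  have hA0 : (p : ℤ) ∣ (swap02 (coeffs a b c)).1 := by simpa [swap02, coeffs] using hpc'
  have hA0' : ¬((p : ℤ) ^ 2 ∣ (swap02 (coeffs a b c)).1) := by simpa [swap02, coeffs] using hc2
  have hA1 : ¬(p : ℤ) ∣ (swap02 (coeffs a b c)).2.1 := by simpa [swap02, coeffs] using hb
  unfold localWeight
  rw [if_neg hpa, if_neg hpb, if_pos hpc]
  by_cases hp2 : p = 2
  · subst hp2
    rw [if_pos rfl, ← hT]
    have h4 : ¬(4 : ℤ) ∣ (swap02 (coeffs a b c)).1 := by simpa using hA0'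
    have hA2 : ¬(2 : ℤ) ∣ (swap02 (coeffs a b c)).2.2 := by simpa [swap02, coeffs] using ha
    have hP'' : ternForm (swap02 (coeffs a b c)) (swap02 P) = 0 := by rw [ternForm_swap02]; exact hP
    have hγ' : (2 : ℤ) ∣ (swap02 P).1 :=
      (two_dvd_fst_iff_eight_dvd (A := swap02 (coeffs a b c)) (P := swap02 P) hA0 h4 hA1 hA2
        (by simpa [swap02] using hβ) (by simpa [swap02] using hα) hP'').2
        (by simpa [swap02, coeffs, add_comm] using h8 rfl)
    obtain ⟨f1, f2⟩ := wTwoA_facts (A := swap02 (coeffs a b c)) (P := swap02 P) hA0 h4 hA1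
      (by simpa [swap02] using hβ) (by simpa [swap02] using hα) hγ' s' t'
    constructor
    · intro hw
      obtain ⟨g1, g2⟩ := f1 hw
      exact ⟨fun h => g1 ((dvd_iff_of_modEq h0 hdp).1 h), (dvd_iff_of_modEq h2 hdp).2 g2⟩
    · intro hw
      obtain ⟨g1, g2, g3, g4, g5⟩ := f2 hw
      rw [show (4 : ℤ) = ((2 : ℕ) : ℤ) ^ 2 by norm_num] at g4 g5
      exact ⟨(dvd_iff_of_modEq h0 hdp).2 g3, (dvd_iff_of_modEq h1 hdp).2 g2,
        (dvd_iff_of_modEq h2 hdp).2 g1, fun h => g4 ((dvd_iff_of_modEq h1 hdp2).1 h),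
        (dvd_iff_of_modEq h2 hdp2).2 g5⟩
  · rw [if_neg hp2, ← hT]
    obtain ⟨f1, f2⟩ := wOdd_facts (A := swap02 (coeffs a b c)) (P := swap02 P) hp hA0 hA0' hA1
      (by simpa [swap02] using hβ) (by simpa [swap02] using hα) hst
    constructor
    · intro hw
      obtain ⟨g1, g2⟩ := f1 hw
      exact ⟨fun h => g1 ((dvd_iff_of_modEq h0 hdp).1 h), (dvd_iff_of_modEq h2 hdp).2 g2⟩
    · intro hw
      obtain ⟨g1, g2, g3, g4, g5⟩ := f2 hw
      exact ⟨(dvd_iff_of_modEq h0 hdp).2 g3, (dvd_iff_of_modEq h1 hdp).2 g2,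
        (dvd_iff_of_modEq h2 hdp).2 g1, fun h => g4 ((dvd_iff_of_modEq h1 hdp2).1 h),
        (dvd_iff_of_modEq h2 hdp2).2 g5⟩

/-- **(G1) at `p = 2 ∤ abc`**: `w = 1 ⟹` not all `Xᵢ` even; `w = 2 ⟹` all `Xᵢ` even and not
all divisible by `4`. [folklore] -/
theorem localWeight_facts_two (hP : ternForm (coeffs a b c) P = 0)
    (hPc : content3 P = 1) (ha : ¬2 ∣ a) (hb : ¬2 ∣ b) (hc : ¬2 ∣ c) (v : ℤ × ℤ) :
    (localWeight a b c P e₁ e₂ 2 ((v.1 : ZMod (2 ^ 2)), (v.2 : ZMod (2 ^ 2))) = 1 →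
      ¬((2 : ℤ) ∣ (conicMap (coeffs a b c) P (v.1 • e₁ + v.2 • e₂)).1 ∧
        (2 : ℤ) ∣ (conicMap (coeffs a b c) P (v.1 • e₁ + v.2 • e₂)).2.1 ∧
        (2 : ℤ) ∣ (conicMap (coeffs a b c) P (v.1 • e₁ + v.2 • e₂)).2.2)) ∧
    (localWeight a b c P e₁ e₂ 2 ((v.1 : ZMod (2 ^ 2)), (v.2 : ZMod (2 ^ 2))) = 2 →
      (2 : ℤ) ∣ (conicMap (coeffs a b c) P (v.1 • e₁ + v.2 • e₂)).1 ∧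
      (2 : ℤ) ∣ (conicMap (coeffs a b c) P (v.1 • e₁ + v.2 • e₂)).2.1 ∧
      (2 : ℤ) ∣ (conicMap (coeffs a b c) P (v.1 • e₁ + v.2 • e₂)).2.2 ∧
      ¬((4 : ℤ) ∣ (conicMap (coeffs a b c) P (v.1 • e₁ + v.2 • e₂)).1 ∧
        (4 : ℤ) ∣ (conicMap (coeffs a b c) P (v.1 • e₁ + v.2 • e₂)).2.1 ∧
        (4 : ℤ) ∣ (conicMap (coeffs a b c) P (v.1 • e₁ + v.2 • e₂)).2.2)) := by
  have ha' : ¬(2 : ℤ) ∣ (a : ℤ) := fun h => ha (by exact_mod_cast h)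
  have hb' : ¬(2 : ℤ) ∣ (b : ℤ) := fun h => hb (by exact_mod_cast h)
  have hc' : ¬(2 : ℤ) ∣ (c : ℤ) := fun h => hc (by exact_mod_cast h)
  obtain ⟨par1, par2⟩ := parities_of_odd ha' hb' hc' hP hPc
  obtain ⟨hdp, hdp2⟩ := natCast_pow_two_dvd 2
  have e4 : ((2 : ℕ) : ℤ) ^ 2 = 4 := by norm_num
  rw [e4] at hdp2
  set u := v.1 • e₁ + v.2 • e₂ with hu
  unfold localWeight
  rw [if_neg ha, if_neg hb, if_neg hc]
  by_cases hγ : (2 : ℤ) ∣ P.2.2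
  · -- chart `0`
    rw [if_pos hγ]
    obtain ⟨hα, hβ⟩ := par2 hγ
    have hαu : IsUnit (P.1 : ZMod (2 ^ 2)) := isUnit_intCast_sq_of_not_dvd Nat.prime_two hα
    obtain ⟨k, hk, h0, h1, h2⟩ := chart0_reduction hP (coprime_natAbs_sq_of_not_dvd Nat.prime_two hα) u
    set s' := u.2.2 - k * P.2.2 with hs'
    set t' := u.2.1 - k * P.2.1 with ht'
    have hT : ((s' : ZMod (2 ^ 2)), (t' : ZMod (2 ^ 2))) =
        transfer0 P e₁ e₂ (2 ^ 2) ((v.1 : ZMod (2 ^ 2)), (v.2 : ZMod (2 ^ 2))) :=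
      transfer0_intCast hαu v hk
    rw [← hT]
    obtain ⟨f1, f2⟩ := wTwoB_facts (A := swap02 (coeffs a b c)) (P := swap02 P)
      (by simpa [swap02, coeffs] using hc') (by simpa [swap02, coeffs] using hb')
      (by simpa [swap02] using hα) (Or.inl ⟨by simpa [swap02] using hγ, by simpa [swap02] using hβ⟩)
      s' t'
    constructor
    · intro hw h
      exact f1 hw ((dvd_iff_of_modEq h0 hdp).1 h.1)
    · intro hw
      obtain ⟨g1, g2, g3, g4⟩ := f2 hw
      refine ⟨(dvd_iff_of_modEq h0 hdp).2 g3, (dvd_iff_of_modEq h1 hdp).2 g2,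
        (dvd_iff_of_modEq h2 hdp).2 g1, fun h => g4 ⟨(dvd_iff_of_modEq h2 hdp2).1 h.2.2,
          (dvd_iff_of_modEq h1 hdp2).1 h.2.1⟩⟩
  · -- chart `2`
    rw [if_neg hγ]
    have hγu : IsUnit (P.2.2 : ZMod (2 ^ 2)) := isUnit_intCast_sq_of_not_dvd Nat.prime_two hγ
    obtain ⟨k, hk, h0, h1, h2⟩ := chart2_reduction hP (coprime_natAbs_sq_of_not_dvd Nat.prime_two hγ) u
    set s' := u.1 - k * P.1 with hs'
    set t' := u.2.1 - k * P.2.1 with ht'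
    have hT : ((s' : ZMod (2 ^ 2)), (t' : ZMod (2 ^ 2))) =
        transfer2 P e₁ e₂ (2 ^ 2) ((v.1 : ZMod (2 ^ 2)), (v.2 : ZMod (2 ^ 2))) :=
      transfer2_intCast hγu v hk
    rw [← hT]
    obtain ⟨f1, f2⟩ := wTwoB_facts (A := coeffs a b c) (P := P) ha' hb' hγ (par1 hγ) s' t'
    constructor
    · intro hw h
      exact f1 hw ((dvd_iff_of_modEq h2 hdp).1 h.2.2)
    · intro hw
      obtain ⟨g1, g2, g3, g4⟩ := f2 hw
      refine ⟨(dvd_iff_of_modEq h0 hdp).2 g1, (dvd_iff_of_modEq h1 hdp).2 g2,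
        (dvd_iff_of_modEq h2 hdp).2 g3, fun h => g4 ⟨(dvd_iff_of_modEq h0 hdp2).1 h.1,
          (dvd_iff_of_modEq h1 hdp2).1 h.2.1⟩⟩

/-! ### (G2) The sums of the local weights -/

/-- **(G2), odd `p ∣ abc`**: `Σ_{η ∈ (ℤ/p²)²} localWeight p η = 2p²(p − 1)`. [folklore] -/
theorem sum_localWeight_odd (hd : Squarefree (a * b * c)) (hP : ternForm (coeffs a b c) P = 0)
    (hPc : content3 P = 1) (he : idet3 P e₁ e₂ = 1) {p : ℕ} (hp : p.Prime) (hp2 : p ≠ 2)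
    (hpd : p ∣ a * b * c) [NeZero (p ^ 2)] [NeZero p] :
    ∑ η : ZMod (p ^ 2) × ZMod (p ^ 2), localWeight a b c P e₁ e₂ p η = 2 * p ^ 2 * (p - 1) := by
  have hsw : Function.Bijective (Prod.swap : ZMod (p ^ 2) × ZMod (p ^ 2) → ZMod (p ^ 2) × ZMod (p ^ 2)) :=
    Prod.swap_bijective
  by_cases hpa : p ∣ a
  · obtain ⟨hb, _, _, hβ, hγ⟩ := units_of_dvd_fst hd hP hPc hp hpa
    have hγu : IsUnit (P.2.2 : ZMod (p ^ 2)) := isUnit_intCast_sq_of_not_dvd hp hγ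
    have e : (fun η => localWeight a b c P e₁ e₂ p η) =
        fun η => wOdd (coeffs a b c) P p (transfer2 P e₁ e₂ (p ^ 2) η) := by
      funext η; unfold localWeight; rw [if_pos hpa, if_neg hp2]
    rw [e, (transfer2_bijective he hγu).sum_comp (wOdd (coeffs a b c) P p)]
    exact sum_wOdd hp hp2 (Int.natCast_dvd_natCast.2 hpa) hb hβ
  by_cases hpb : p ∣ b
  · have hd' : Squarefree (b * a * c) := by rwa [mul_comm b a]
    have hP' : ternForm (coeffs b a c) (swap01 P) = 0 := by
      rw [show coeffs b a c = swap01 (coeffs a b c) from rfl, ternForm_swap01]; exact hP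
    have hPc' : content3 (swap01 P) = 1 := by rw [content3_swap01]; exact hPc
    obtain ⟨ha, _, _, hα, hγ⟩ := units_of_dvd_fst hd' hP' hPc' hp hpb
    simp only [swap01] at hα hγ
    have hγu : IsUnit (P.2.2 : ZMod (p ^ 2)) := isUnit_intCast_sq_of_not_dvd hp hγ
    have e : (fun η => localWeight a b c P e₁ e₂ p η) =
        fun η => (wOdd (swap01 (coeffs a b c)) (swap01 P) p ∘ Prod.swap) (transfer2 P e₁ e₂ (p ^ 2) η) := by
      funext η; unfold localWeight; rw [if_neg hpa, if_pos hpb, if_neg hp2]; rfl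
    rw [e, (transfer2_bijective he hγu).sum_comp (wOdd (swap01 (coeffs a b c)) (swap01 P) p ∘ Prod.swap),
      show (fun η => (wOdd (swap01 (coeffs a b c)) (swap01 P) p ∘ Prod.swap) η) =
        fun η => wOdd (swap01 (coeffs a b c)) (swap01 P) p (Prod.swap η) from rfl,
      hsw.sum_comp (wOdd (swap01 (coeffs a b c)) (swap01 P) p)]
    exact sum_wOdd hp hp2 (Int.natCast_dvd_natCast.2 hpb) ha (by simpa [swap01] using hα)
  have hpc : p ∣ c := by
    rcases (Nat.Prime.dvd_mul hp).1 hpd with h | h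
    · rcases (Nat.Prime.dvd_mul hp).1 h with h | h
      · exact absurd h hpa
      · exact absurd h hpb
    · exact h
  obtain ⟨_, hb, _, hα, hβ⟩ := units_of_dvd_thd hd hP hPc hp hpc
  have hαu : IsUnit (P.1 : ZMod (p ^ 2)) := isUnit_intCast_sq_of_not_dvd hp hα
  have e : (fun η => localWeight a b c P e₁ e₂ p η) =
      fun η => wOdd (swap02 (coeffs a b c)) (swap02 P) p (transfer0 P e₁ e₂ (p ^ 2) η) := by
    funext η; unfold localWeight; rw [if_neg hpa, if_neg hpb, if_pos hpc, if_neg hp2]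
  rw [e, (transfer0_bijective he hαu).sum_comp (wOdd (swap02 (coeffs a b c)) (swap02 P) p)]
  exact sum_wOdd hp hp2 (by simpa [swap02, coeffs] using Int.natCast_dvd_natCast.2 hpc) hb
    (by simpa [swap02] using hβ)

/-- **(G2), `p = 2`**: `Σ_{η ∈ (ℤ/4)²} localWeight 2 η = 16` (in every configuration).
[folklore] -/
theorem sum_localWeight_two (hd : Squarefree (a * b * c)) (hP : ternForm (coeffs a b c) P = 0)
    (hPc : content3 P = 1) (he : idet3 P e₁ e₂ = 1) :
    ∑ η : ZMod (2 ^ 2) × ZMod (2 ^ 2), localWeight a b c P e₁ e₂ 2 η = 16 := by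
  have hsw : Function.Bijective (Prod.swap : ZMod (2 ^ 2) × ZMod (2 ^ 2) → ZMod (2 ^ 2) × ZMod (2 ^ 2)) :=
    Prod.swap_bijective
  by_cases hpa : 2 ∣ a
  · obtain ⟨_, _, _, _, hγ⟩ := units_of_dvd_fst hd hP hPc Nat.prime_two hpa
    have hγu : IsUnit (P.2.2 : ZMod (2 ^ 2)) := isUnit_intCast_sq_of_not_dvd Nat.prime_two hγ
    have e : (fun η => localWeight a b c P e₁ e₂ 2 η) = fun η => wTwoA 2 (transfer2 P e₁ e₂ (2 ^ 2) η) := by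
      funext η; unfold localWeight; rw [if_pos hpa, if_pos rfl]
    rw [e, (transfer2_bijective he hγu).sum_comp (wTwoA 2)]
    exact sum_wTwoA
  by_cases hpb : 2 ∣ b
  · have hd' : Squarefree (b * a * c) := by rwa [mul_comm b a]
    have hP' : ternForm (coeffs b a c) (swap01 P) = 0 := by
      rw [show coeffs b a c = swap01 (coeffs a b c) from rfl, ternForm_swap01]; exact hP
    have hPc' : content3 (swap01 P) = 1 := by rw [content3_swap01]; exact hPc
    obtain ⟨_, _, _, _, hγ⟩ := units_of_dvd_fst hd' hP' hPc' Nat.prime_two hpb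
    simp only [swap01] at hγ
    have hγu : IsUnit (P.2.2 : ZMod (2 ^ 2)) := isUnit_intCast_sq_of_not_dvd Nat.prime_two hγ
    have e : (fun η => localWeight a b c P e₁ e₂ 2 η) =
        fun η => (wTwoA 2 ∘ Prod.swap) (transfer2 P e₁ e₂ (2 ^ 2) η) := by
      funext η; unfold localWeight; rw [if_neg hpa, if_pos hpb, if_pos rfl]; rfl
    rw [e, (transfer2_bijective he hγu).sum_comp (wTwoA 2 ∘ Prod.swap),
      show (fun η => (wTwoA 2 ∘ Prod.swap) η) = fun η => wTwoA 2 (Prod.swap η) from rfl,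
      hsw.sum_comp (wTwoA 2)]
    exact sum_wTwoA
  by_cases hpc : 2 ∣ c
  · obtain ⟨_, _, _, hα, _⟩ := units_of_dvd_thd hd hP hPc Nat.prime_two hpc
    have hαu : IsUnit (P.1 : ZMod (2 ^ 2)) := isUnit_intCast_sq_of_not_dvd Nat.prime_two hα
    have e : (fun η => localWeight a b c P e₁ e₂ 2 η) = fun η => wTwoA 2 (transfer0 P e₁ e₂ (2 ^ 2) η) := by
      funext η; unfold localWeight; rw [if_neg hpa, if_neg hpb, if_pos hpc, if_pos rfl]
    rw [e, (transfer0_bijective he hαu).sum_comp (wTwoA 2)]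
    exact sum_wTwoA
  have ha' : ¬(2 : ℤ) ∣ (a : ℤ) := fun h => hpa (by exact_mod_cast h)
  have hb' : ¬(2 : ℤ) ∣ (b : ℤ) := fun h => hpb (by exact_mod_cast h)
  have hc' : ¬(2 : ℤ) ∣ (c : ℤ) := fun h => hpc (by exact_mod_cast h)
  obtain ⟨_, par2⟩ := parities_of_odd ha' hb' hc' hP hPc
  by_cases hγ : (2 : ℤ) ∣ P.2.2
  · obtain ⟨hα, _⟩ := par2 hγ
    have hαu : IsUnit (P.1 : ZMod (2 ^ 2)) := isUnit_intCast_sq_of_not_dvd Nat.prime_two hα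
    have e : (fun η => localWeight a b c P e₁ e₂ 2 η) = fun η => wTwoB 2 (transfer0 P e₁ e₂ (2 ^ 2) η) := by
      funext η; unfold localWeight; rw [if_neg hpa, if_neg hpb, if_neg hpc, if_pos hγ]
    rw [e, (transfer0_bijective he hαu).sum_comp (wTwoB 2)]
    exact sum_wTwoB
  · have hγu : IsUnit (P.2.2 : ZMod (2 ^ 2)) := isUnit_intCast_sq_of_not_dvd Nat.prime_two hγ
    have e : (fun η => localWeight a b c P e₁ e₂ 2 η) = fun η => wTwoB 2 (transfer2 P e₁ e₂ (2 ^ 2) η) := by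
      funext η; unfold localWeight; rw [if_neg hpa, if_neg hpb, if_neg hpc, if_neg hγ]
    rw [e, (transfer2_bijective he hγu).sum_comp (wTwoB 2)]
    exact sum_wTwoB

end LocalWeightFacts2


/-! ## The global weight modulo `M = ∏_{p ∣ 2abc} p²` -/

section Global

open Finset

/-- The set of primes dividing `2abc`. [folklore] -/
def primeSet (a b c : ℕ) : Finset ℕ := (2 * (a * b * c)).primeFactors

/-- The modulus `M = ∏_{p ∣ 2abc} p²` (a product over the subtype, to match
`ZMod.prodEquivPi`). [folklore] -/
def modulus (a b c : ℕ) : ℕ := ∏ q : primeSet a b c, (q : ℕ) ^ 2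

/-- **The global weight** `W(ξ) = ∏_{p ∣ 2abc} localWeight_p(ξ mod p²)` of a class
`ξ ∈ (ℤ/M)²`: `0` unless every local condition holds, and then the product of the local
`p`-parts of the content. [folklore] -/
noncomputable def globalWeight (a b c : ℕ) (P e₁ e₂ : ℤ × ℤ × ℤ)
    (ξ : ZMod (modulus a b c) × ZMod (modulus a b c)) : ℕ :=
  ∏ p ∈ primeSet a b c,
    localWeight a b c P e₁ e₂ p ((ZMod.cast ξ.1 : ZMod (p ^ 2)), (ZMod.cast ξ.2 : ZMod (p ^ 2)))

/-- The same product read on an integer vector. [folklore] -/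
noncomputable def intWeight (a b c : ℕ) (P e₁ e₂ : ℤ × ℤ × ℤ) (v : ℤ × ℤ) : ℕ :=
  ∏ p ∈ primeSet a b c, localWeight a b c P e₁ e₂ p ((v.1 : ZMod (p ^ 2)), (v.2 : ZMod (p ^ 2)))

variable {a b c : ℕ}

/-- Members of `primeSet` are primes dividing `2abc`. [folklore] -/
theorem mem_primeSet (habc : a * b * c ≠ 0) {p : ℕ} :
    p ∈ primeSet a b c ↔ p.Prime ∧ (p = 2 ∨ p ∣ a * b * c) := by
  rw [primeSet, Nat.mem_primeFactors]
  constructor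
  · rintro ⟨hp, hdvd, -⟩
    refine ⟨hp, ?_⟩
    rcases (Nat.Prime.dvd_mul hp).1 hdvd with h | h
    · exact Or.inl ((Nat.prime_dvd_prime_iff_eq hp Nat.prime_two).1 h)
    · exact Or.inr h
  · rintro ⟨hp, h⟩
    refine ⟨hp, ?_, by positivity⟩
    rcases h with rfl | h
    · exact dvd_mul_right 2 _
    · exact h.mul_left 2

/-- `2 ∈ primeSet`. [folklore] -/
theorem two_mem_primeSet (habc : a * b * c ≠ 0) : 2 ∈ primeSet a b c :=
  (mem_primeSet habc).2 ⟨Nat.prime_two, Or.inl rfl⟩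

/-- `p² ∣ M` for `p ∈ primeSet`. [folklore] -/
theorem sq_dvd_modulus {p : ℕ} (hp : p ∈ primeSet a b c) : p ^ 2 ∣ modulus a b c := by
  rw [modulus, ← Finset.prod_coe_sort (primeSet a b c) (fun q => q ^ 2) |>.symm.trans rfl]
  exact Finset.dvd_prod_of_mem (fun q => q ^ 2) hp

/-- `M ≠ 0`. [folklore] -/
theorem modulus_ne_zero : modulus a b c ≠ 0 := by
  rw [modulus]
  exact Finset.prod_ne_zero_iff.2 fun q _ => pow_ne_zero 2 (Nat.prime_of_mem_primeFactors q.2).ne_zero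

/-- `0 < M`. [folklore] -/
theorem modulus_pos : 0 < modulus a b c := Nat.pos_of_ne_zero modulus_ne_zero

/-- `M ≠ 0` as an instance (so that `ZMod M` is a `Fintype`). [folklore] -/
instance modulus_neZero : NeZero (modulus a b c) := ⟨modulus_ne_zero⟩

/-- `p² ≠ 0` for `p ∈ primeSet`, as an instance on the subtype. [folklore] -/
instance sq_primeSet_neZero (q : primeSet a b c) : NeZero ((q : ℕ) ^ 2) :=
  ⟨pow_ne_zero 2 (Nat.prime_of_mem_primeFactors q.2).ne_zero⟩

/-- The prime factors of `M` lie in `primeSet`. [folklore] -/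
theorem dvd_modulus_imp {p : ℕ} (hp : p.Prime) (h : p ∣ modulus a b c) : p ∈ primeSet a b c := by
  rw [modulus, Finset.prod_coe_sort (primeSet a b c) (fun q => q ^ 2) |>.symm.trans rfl |>.symm] at h
  obtain ⟨q, hq, hpq⟩ := (Prime.dvd_finsetProd_iff (Nat.prime_iff.1 hp) _).1 h
  have := (Nat.prime_dvd_prime_iff_eq hp (Nat.prime_of_mem_primeFactors hq)).1 (hp.dvd_of_dvd_pow hpq)
  rwa [this]

/-- **Class compatibility**: the global weight of the class of an integer vector is its integer
weight. [folklore] -/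
theorem globalWeight_intCast (P e₁ e₂ : ℤ × ℤ × ℤ) (v : ℤ × ℤ) :
    globalWeight a b c P e₁ e₂ ((v.1 : ZMod (modulus a b c)), (v.2 : ZMod (modulus a b c))) =
      intWeight a b c P e₁ e₂ v := by
  unfold globalWeight intWeight
  refine Finset.prod_congr rfl fun p hp => ?_
  rw [ZMod.cast_intCast (sq_dvd_modulus hp), ZMod.cast_intCast (sq_dvd_modulus hp)]

/-! ### Linearity of the transfers and vanishing on `p`-divisible classes -/

/-- `combZ (c • η) = c • combZ η`. [folklore] -/
theorem combZ_smul (e₁ e₂ : ℤ × ℤ × ℤ) (n : ℕ) (r : ZMod n) (η : ZMod n × ZMod n) :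
    combZ e₁ e₂ n (r • η) = r • combZ e₁ e₂ n η := by
  ext <;> simp [combZ, cast3, smul_eq_mul] <;> ring

/-- `transfer2 (c • η) = c • transfer2 η`. [folklore] -/
theorem transfer2_smul (P e₁ e₂ : ℤ × ℤ × ℤ) (n : ℕ) (r : ZMod n) (η : ZMod n × ZMod n) :
    transfer2 P e₁ e₂ n (r • η) = r • transfer2 P e₁ e₂ n η := by
  ext <;> simp only [transfer2, combZ_smul, Prod.smul_fst, Prod.smul_snd, smul_eq_mul] <;> ring

/-- `transfer0 (c • η) = c • transfer0 η`. [folklore] -/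
theorem transfer0_smul (P e₁ e₂ : ℤ × ℤ × ℤ) (n : ℕ) (r : ZMod n) (η : ZMod n × ZMod n) :
    transfer0 P e₁ e₂ n (r • η) = r • transfer0 P e₁ e₂ n η := by
  ext <;> simp only [transfer0, combZ_smul, Prod.smul_fst, Prod.smul_snd, smul_eq_mul] <;> ring

/-- `red p (p x) = 0`. [folklore] -/
theorem red_natCast_mul (p : ℕ) (x : ZMod (p ^ 2)) : red p ((p : ZMod (p ^ 2)) * x) = 0 := by
  rw [map_mul, map_natCast, ZMod.natCast_self, zero_mul]

/-- `wOdd` vanishes on multiples of `p`. [folklore] -/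
theorem wOdd_smul_eq_zero (A P : ℤ × ℤ × ℤ) (p : ℕ) (θ : ZMod (p ^ 2) × ZMod (p ^ 2)) :
    wOdd A P p ((p : ZMod (p ^ 2)) • θ) = 0 := by
  unfold wOdd
  simp only [Prod.smul_snd, Prod.smul_fst, smul_eq_mul, red_natCast_mul, if_true, not_true,
    false_and, if_false]

/-- `wTwoA` vanishes on multiples of `p`. [folklore] -/
theorem wTwoA_smul_eq_zero (p : ℕ) (θ : ZMod (p ^ 2) × ZMod (p ^ 2)) :
    wTwoA p ((p : ZMod (p ^ 2)) • θ) = 0 := by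
  unfold wTwoA
  simp only [Prod.smul_snd, Prod.smul_fst, smul_eq_mul, red_natCast_mul, if_true]

/-- `wTwoB` vanishes on multiples of `p`. [folklore] -/
theorem wTwoB_smul_eq_zero (p : ℕ) (θ : ZMod (p ^ 2) × ZMod (p ^ 2)) :
    wTwoB p ((p : ZMod (p ^ 2)) • θ) = 0 := by
  unfold wTwoB
  simp only [Prod.smul_snd, Prod.smul_fst, smul_eq_mul, red_natCast_mul, if_true]

/-- **The local weight vanishes on `p`-divisible classes.** [folklore] -/
theorem localWeight_eq_zero_of_dvd (P e₁ e₂ : ℤ × ℤ × ℤ) {p : ℕ} {s t : ℤ}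
    (hs : (p : ℤ) ∣ s) (ht : (p : ℤ) ∣ t) :
    localWeight a b c P e₁ e₂ p ((s : ZMod (p ^ 2)), (t : ZMod (p ^ 2))) = 0 := by
  obtain ⟨s₁, rfl⟩ := hs
  obtain ⟨t₁, rfl⟩ := ht
  have e : (((p * s₁ : ℤ) : ZMod (p ^ 2)), ((p * t₁ : ℤ) : ZMod (p ^ 2))) =
      (p : ZMod (p ^ 2)) • (((s₁ : ZMod (p ^ 2)), (t₁ : ZMod (p ^ 2))) : ZMod (p ^ 2) × ZMod (p ^ 2)) := by
    ext <;> simp [smul_eq_mul]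
  rw [e]
  unfold localWeight
  simp only [transfer2_smul, transfer0_smul]
  have hsw : ∀ θ : ZMod (p ^ 2) × ZMod (p ^ 2),
      ((p : ZMod (p ^ 2)) • θ).swap = (p : ZMod (p ^ 2)) • θ.swap := fun θ => rfl
  simp only [hsw]
  split_ifs <;> first
    | exact wOdd_smul_eq_zero _ _ _ _
    | exact wTwoA_smul_eq_zero _ _
    | exact wTwoB_smul_eq_zero _ _

/-- **(G4) Classes of positive weight are primitive modulo `M`**: if `globalWeight ξ ≠ 0` then the
representative `(val ξ₁, val ξ₂)` satisfies `gcd(ξ₁, ξ₂, M) = 1`. [folklore] -/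
theorem coprime_of_globalWeight_ne_zero (P e₁ e₂ : ℤ × ℤ × ℤ)
    {ξ : ZMod (modulus a b c) × ZMod (modulus a b c)} (hW : globalWeight a b c P e₁ e₂ ξ ≠ 0) :
    Nat.Coprime (Int.gcd (ξ.1.val : ℤ) (ξ.2.val : ℤ)) (modulus a b c) := by
  haveI : NeZero (modulus a b c) := ⟨modulus_ne_zero⟩
  rw [Nat.coprime_iff_gcd_eq_one]
  by_contra h
  obtain ⟨p, hp, hpdvd⟩ := Nat.exists_prime_and_dvd h
  have hp1 : p ∣ Int.gcd (ξ.1.val : ℤ) (ξ.2.val : ℤ) := hpdvd.trans (Nat.gcd_dvd_left _ _)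
  have hp2 : p ∣ modulus a b c := hpdvd.trans (Nat.gcd_dvd_right _ _)
  have hpS : p ∈ primeSet a b c := dvd_modulus_imp hp hp2
  have hs : (p : ℤ) ∣ (ξ.1.val : ℤ) := (Int.natCast_dvd_natCast.2 hp1).trans (Int.gcd_dvd_left _ _)
  have ht : (p : ℤ) ∣ (ξ.2.val : ℤ) := (Int.natCast_dvd_natCast.2 hp1).trans (Int.gcd_dvd_right _ _)
  apply hW
  unfold globalWeight
  apply Finset.prod_eq_zero hpS
  have e1 : (ZMod.cast ξ.1 : ZMod (p ^ 2)) = (((ξ.1.val : ℤ)) : ZMod (p ^ 2)) := by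
    rw [ZMod.cast_eq_val]; push_cast; rfl
  have e2 : (ZMod.cast ξ.2 : ZMod (p ^ 2)) = (((ξ.2.val : ℤ)) : ZMod (p ^ 2)) := by
    rw [ZMod.cast_eq_val]; push_cast; rfl
  rw [e1, e2]
  exact localWeight_eq_zero_of_dvd P e₁ e₂ hs ht

/-! ### (G3) The total weight factors over the primes -/

/-- **(G3)** `Σ_{ξ ∈ (ℤ/M)²} W(ξ) = ∏_{p ∣ 2abc} Σ_{η ∈ (ℤ/p²)²} localWeight_p(η)` (Chinese remainder
theorem; the product runs over the subtype of `primeSet`). [folklore] -/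
theorem sum_globalWeight (P e₁ e₂ : ℤ × ℤ × ℤ) :
    ∑ ξ : ZMod (modulus a b c) × ZMod (modulus a b c), globalWeight a b c P e₁ e₂ ξ =
      ∏ q : primeSet a b c,
        ∑ η : ZMod ((q : ℕ) ^ 2) × ZMod ((q : ℕ) ^ 2), localWeight a b c P e₁ e₂ q η := by
  classical
  set S := primeSet a b c with hS
  let av : S → ℕ := fun q => (q : ℕ) ^ 2
  have hcop : Pairwise (Function.onFun Nat.Coprime av) := by
    intro q q' hne
    have hq := Nat.prime_of_mem_primeFactors q.2
    have hq' := Nat.prime_of_mem_primeFactors q'.2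
    exact Nat.Coprime.pow 2 2 ((Nat.coprime_primes hq hq').2 fun h => hne (Subtype.ext h))
  let φ : ZMod (modulus a b c) ≃+* ((q : S) → ZMod (av q)) := ZMod.prodEquivPi av hcop
  have hφ : ∀ (x : ZMod (modulus a b c)) (q : S), φ x q = (ZMod.cast x : ZMod ((q : ℕ) ^ 2)) := by
    intro x q
    show ZMod.prodEquivPi av hcop x q = _
    rw [ZMod.prodEquivPi_apply, ZMod.castHom_apply]
    rfl
  -- pair the two components
  let ψ : ((q : S) → ZMod (av q)) × ((q : S) → ZMod (av q)) ≃ ((q : S) → ZMod (av q) × ZMod (av q)) :=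
    { toFun := fun x q => (x.1 q, x.2 q)
      invFun := fun z => (fun q => (z q).1, fun q => (z q).2)
      left_inv := fun x => rfl
      right_inv := fun z => rfl }
  let Θ := (Equiv.prodCongr φ.toEquiv φ.toEquiv).trans ψ
  have step1 : ∑ ξ : ZMod (modulus a b c) × ZMod (modulus a b c), globalWeight a b c P e₁ e₂ ξ =
      ∑ z : (q : S) → ZMod (av q) × ZMod (av q), ∏ q : S, localWeight a b c P e₁ e₂ q (z q) := by
    refine Fintype.sum_equiv Θ _ _ fun ξ => ?_
    unfold globalWeight
    rw [← Finset.prod_coe_sort S]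
    refine Finset.prod_congr rfl fun q _ => ?_
    have e1 : (Θ ξ q).1 = (ZMod.cast ξ.1 : ZMod ((q : ℕ) ^ 2)) := hφ ξ.1 q
    have e2 : (Θ ξ q).2 = (ZMod.cast ξ.2 : ZMod ((q : ℕ) ^ 2)) := hφ ξ.2 q
    rw [← e1, ← e2]
  rw [step1, Fintype.prod_sum]

/-- **Value of the total weight**: `Σ_ξ W(ξ) = 16 · ∏_{odd p ∣ abc} 2p²(p−1)`. [folklore] -/
theorem sum_globalWeight_eq (hd : Squarefree (a * b * c)) {P e₁ e₂ : ℤ × ℤ × ℤ}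
    (hP : ternForm (coeffs a b c) P = 0) (hPc : content3 P = 1) (he : idet3 P e₁ e₂ = 1) :
    ∑ ξ : ZMod (modulus a b c) × ZMod (modulus a b c), globalWeight a b c P e₁ e₂ ξ =
      16 * ∏ p ∈ (primeSet a b c).erase 2, 2 * p ^ 2 * (p - 1) := by
  classical
  have habc : a * b * c ≠ 0 := hd.ne_zero
  set val : ℕ → ℕ := fun p => if p = 2 then 16 else 2 * p ^ 2 * (p - 1) with hval
  have hloc : ∀ q : primeSet a b c,
      ∑ η : ZMod ((q : ℕ) ^ 2) × ZMod ((q : ℕ) ^ 2), localWeight a b c P e₁ e₂ q η = val q := by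
    intro q
    obtain ⟨hqp, h⟩ := (mem_primeSet habc).1 q.2
    by_cases hq2 : (q : ℕ) = 2
    · rw [hval]; simp only [hq2, if_true]
      have key : ∀ p : ℕ, p = 2 → ∀ [NeZero (p ^ 2)],
          ∑ η : ZMod (p ^ 2) × ZMod (p ^ 2), localWeight a b c P e₁ e₂ p η = 16 := by
        rintro p rfl _
        convert sum_localWeight_two hd hP hPc he
      exact key q hq2
    · rw [hval]; simp only [hq2, if_false]
      haveI : NeZero (q : ℕ) := ⟨hqp.ne_zero⟩
      exact sum_localWeight_odd hd hP hPc he hqp hq2 (h.resolve_left hq2)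
  rw [sum_globalWeight, Fintype.prod_congr _ _ hloc, Finset.prod_coe_sort (primeSet a b c) val,
    ← Finset.mul_prod_erase _ _ (two_mem_primeSet habc)]
  simp only [hval, if_true]
  congr 1
  refine Finset.prod_congr rfl fun p hp => ?_
  rw [if_neg (Finset.mem_erase.1 hp).1]

end Global


/-! ## (R-div) Positive weight: the weight divides the content, and the divisibility conditions -/

section GlobalFacts

open Finset

variable {a b c : ℕ} {P e₁ e₂ : ℤ × ℤ × ℤ}

/-- From `p² ∣ g q`, `p ∣ g`, `p² ∤ g` deduce `p ∣ q` (`p` prime). [folklore] -/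
theorem dvd_of_sq_dvd_mul {p : ℕ} (hp : p.Prime) {g q : ℤ} (h : (p : ℤ) ^ 2 ∣ g * q)
    (hg : (p : ℤ) ∣ g) (hg2 : ¬((p : ℤ) ^ 2 ∣ g)) : (p : ℤ) ∣ q := by
  have hp' : Prime (p : ℤ) := Nat.prime_iff_prime_int.1 hp
  obtain ⟨g₁, rfl⟩ := hg
  have hg₁ : ¬(p : ℤ) ∣ g₁ := fun h1 => hg2 (by rw [pow_two]; exact mul_dvd_mul_left _ h1)
  rw [pow_two, mul_assoc] at h
  have h2 : (p : ℤ) ∣ g₁ * q := (mul_dvd_mul_iff_left (by exact_mod_cast hp.ne_zero)).1 h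
  exact (hp'.dvd_or_dvd h2).resolve_left hg₁

/-- A square-free natural number divides an integer as soon as all its prime factors do.
[folklore] -/
theorem natCast_dvd_of_forall_prime {n : ℕ} (hn : Squarefree n) {q : ℤ}
    (h : ∀ p : ℕ, p.Prime → p ∣ n → (p : ℤ) ∣ q) : (n : ℤ) ∣ q := by
  rw [← Nat.prod_primeFactors_of_squarefree hn]
  exact Int.natCast_dvd.2 (Finset.prod_primes_dvd q.natAbs
    (fun p hp => Nat.prime_iff.1 (Nat.prime_of_mem_primeFactors hp))
    (fun p hp => Int.natCast_dvd.1 (h p (Nat.prime_of_mem_primeFactors hp)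
      (Nat.dvd_of_mem_primeFactors hp))))

/-- **(R-div).** Let `abc` be square-free, `P` a primitive zero of `(a,b,−c)`, `det(P,e₁,e₂) = 1`,
and assume the `2`-adic solubility conditions (`2 ∣ a ⟹ 8 ∣ b − c`, `2 ∣ b ⟹ 8 ∣ a − c`,
`2 ∣ c ⟹ 8 ∣ a + b`). For a primitive `v ∈ ℤ²` with `intWeight v ≠ 0` and
`X = conicMap (a,b,−c) P (v₁e₁ + v₂e₂)`, `g = content3 X`: `intWeight v ∣ g`, and
`a ∣ X₀/g`, `b ∣ X₁/g`, `c ∣ X₂/g`. [folklore] -/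
theorem intWeight_facts (hd : Squarefree (a * b * c)) (hP : ternForm (coeffs a b c) P = 0)
    (hPc : content3 P = 1) (he : idet3 P e₁ e₂ = 1)
    (h8a : 2 ∣ a → (8 : ℤ) ∣ (b : ℤ) - c) (h8b : 2 ∣ b → (8 : ℤ) ∣ (a : ℤ) - c)
    (h8c : 2 ∣ c → (8 : ℤ) ∣ (a : ℤ) + b)
    {v : ℤ × ℤ} (hv : Int.gcd v.1 v.2 = 1) (hW : intWeight a b c P e₁ e₂ v ≠ 0) :
    intWeight a b c P e₁ e₂ v ∣ content3 (conicMap (coeffs a b c) P (v.1 • e₁ + v.2 • e₂)) ∧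
      (a : ℤ) ∣ (conicMap (coeffs a b c) P (v.1 • e₁ + v.2 • e₂)).1 /
        content3 (conicMap (coeffs a b c) P (v.1 • e₁ + v.2 • e₂)) ∧
      (b : ℤ) ∣ (conicMap (coeffs a b c) P (v.1 • e₁ + v.2 • e₂)).2.1 /
        content3 (conicMap (coeffs a b c) P (v.1 • e₁ + v.2 • e₂)) ∧
      (c : ℤ) ∣ (conicMap (coeffs a b c) P (v.1 • e₁ + v.2 • e₂)).2.2 /
        content3 (conicMap (coeffs a b c) P (v.1 • e₁ + v.2 • e₂)) := by
  have habc : a * b * c ≠ 0 := hd.ne_zero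
  set X := conicMap (coeffs a b c) P (v.1 • e₁ + v.2 • e₂) with hX
  set g := content3 X with hg
  obtain ⟨hg1, hg2, hg3⟩ := content3_dvd X
  set w : ℕ → ℕ := fun p => localWeight a b c P e₁ e₂ p ((v.1 : ZMod (p ^ 2)), (v.2 : ZMod (p ^ 2)))
    with hw
  have hwne : ∀ p ∈ primeSet a b c, w p ≠ 0 := by
    intro p hp h0
    exact hW (Finset.prod_eq_zero hp h0)
  have hrelS : ∀ p ∈ primeSet a b c, p.Prime ∧ (p ∣ a ∨ p ∣ b ∨ p ∣ c ∨ p = 2) := by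
    intro p hpS
    obtain ⟨hp, hrel⟩ := (mem_primeSet habc).1 hpS
    refine ⟨hp, ?_⟩
    rcases hrel with h | h
    · exact Or.inr (Or.inr (Or.inr h))
    · rcases (Nat.Prime.dvd_mul hp).1 h with h | h
      · rcases (Nat.Prime.dvd_mul hp).1 h with h | h
        · exact Or.inl h
        · exact Or.inr (Or.inl h)
      · exact Or.inr (Or.inr (Or.inl h))
  have hw1p : ∀ p ∈ primeSet a b c, w p = 1 ∨ w p = p := by
    intro p hpS
    obtain ⟨hp, hrel'⟩ := hrelS p hpS
    have hvals := localWeight_values a b c P e₁ e₂ hrel' ((v.1 : ZMod (p ^ 2)), (v.2 : ZMod (p ^ 2)))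
    change w p = 0 ∨ w p = 1 ∨ w p = p at hvals
    exact hvals.resolve_left (hwne p hpS)
  -- the per-prime claims
  have claim : ∀ p ∈ primeSet a b c,
      ((w p : ℤ) ∣ (g : ℤ)) ∧ (p ∣ a → (p : ℤ) ∣ X.1 / g) ∧ (p ∣ b → (p : ℤ) ∣ X.2.1 / g) ∧
        (p ∣ c → (p : ℤ) ∣ X.2.2 / g) := by
    intro p hpS
    obtain ⟨hp, hrel'⟩ := hrelS p hpS
    have hp' : Prime (p : ℤ) := Nat.prime_iff_prime_int.1 hp
    have hvals : w p = 0 ∨ w p = 1 ∨ w p = p := Or.inr (hw1p p hpS)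
    have hw0 := hwne p hpS
    -- `X = g • (X / g)`
    have eX0 : X.1 = g * (X.1 / g) := (Int.mul_ediv_cancel' hg1).symm
    have eX1 : X.2.1 = g * (X.2.1 / g) := (Int.mul_ediv_cancel' hg2).symm
    have eX2 : X.2.2 = g * (X.2.2 / g) := (Int.mul_ediv_cancel' hg3).symm
    by_cases hpa : p ∣ a
    · obtain ⟨hb, hc, _, _, _⟩ := units_of_dvd_fst hd hP hPc hp hpa
      have hpb : ¬p ∣ b := fun h => hb (Int.natCast_dvd_natCast.2 h)
      have hpc : ¬p ∣ c := fun h => hc (Int.natCast_dvd_natCast.2 h)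
      obtain ⟨f1, f2⟩ := localWeight_facts_a hd hP hPc he hp hpa (fun h2 => h8a (h2 ▸ hpa)) hv
      refine ⟨?_, fun _ => ?_, fun h => absurd h hpb, fun h => absurd h hpc⟩
      · rcases hvals with h | h | h
        · exact absurd h hw0
        · rw [h]; simp
        · rw [h]; obtain ⟨d0, d1, d2, -, -⟩ := f2 h
          exact Int.natCast_dvd_natCast.2 (dvd_content3 d0 d1 d2)
      · rcases hvals with h | h | h
        · exact absurd h hw0
        · obtain ⟨n2, d0⟩ := f1 h
          have hpg : ¬(p : ℤ) ∣ g := fun h' => n2 (h'.trans hg3)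
          rw [eX0] at d0
          exact (hp'.dvd_or_dvd d0).resolve_left hpg
        · obtain ⟨d0, d1, d2, n1, s0⟩ := f2 h
          have hpg : (p : ℤ) ∣ g := Int.natCast_dvd_natCast.2 (dvd_content3 d0 d1 d2)
          have hpg2 : ¬((p : ℤ) ^ 2 ∣ g) := fun h' => n1 (h'.trans hg2)
          rw [eX0] at s0
          exact dvd_of_sq_dvd_mul hp s0 hpg hpg2
    by_cases hpb : p ∣ b
    · have hd' : Squarefree (b * a * c) := by rwa [mul_comm b a]
      have hP' : ternForm (coeffs b a c) (swap01 P) = 0 := by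
        rw [show coeffs b a c = swap01 (coeffs a b c) from rfl, ternForm_swap01]; exact hP
      have hPc' : content3 (swap01 P) = 1 := by rw [content3_swap01]; exact hPc
      obtain ⟨_, hc, _, _, _⟩ := units_of_dvd_fst hd' hP' hPc' hp hpb
      have hpc : ¬p ∣ c := fun h => hc (Int.natCast_dvd_natCast.2 h)
      obtain ⟨f1, f2⟩ := localWeight_facts_b hd hP hPc he hp hpb (fun h2 => h8b (h2 ▸ hpb)) hv
      refine ⟨?_, fun h => absurd h hpa, fun _ => ?_, fun h => absurd h hpc⟩
      · rcases hvals with h | h | h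
        · exact absurd h hw0
        · rw [h]; simp
        · rw [h]; obtain ⟨d0, d1, d2, -, -⟩ := f2 h
          exact Int.natCast_dvd_natCast.2 (dvd_content3 d0 d1 d2)
      · rcases hvals with h | h | h
        · exact absurd h hw0
        · obtain ⟨n2, d1⟩ := f1 h
          have hpg : ¬(p : ℤ) ∣ g := fun h' => n2 (h'.trans hg3)
          rw [eX1] at d1
          exact (hp'.dvd_or_dvd d1).resolve_left hpg
        · obtain ⟨d0, d1, d2, n0, s1⟩ := f2 h
          have hpg : (p : ℤ) ∣ g := Int.natCast_dvd_natCast.2 (dvd_content3 d0 d1 d2)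
          have hpg2 : ¬((p : ℤ) ^ 2 ∣ g) := fun h' => n0 (h'.trans hg1)
          rw [eX1] at s1
          exact dvd_of_sq_dvd_mul hp s1 hpg hpg2
    by_cases hpc : p ∣ c
    · obtain ⟨f1, f2⟩ := localWeight_facts_c hd hP hPc he hp hpc (fun h2 => h8c (h2 ▸ hpc)) hv
      refine ⟨?_, fun h => absurd h hpa, fun h => absurd h hpb, fun _ => ?_⟩
      · rcases hvals with h | h | h
        · exact absurd h hw0
        · rw [h]; simp
        · rw [h]; obtain ⟨d0, d1, d2, -, -⟩ := f2 h
          exact Int.natCast_dvd_natCast.2 (dvd_content3 d0 d1 d2)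
      · rcases hvals with h | h | h
        · exact absurd h hw0
        · obtain ⟨n0, d2⟩ := f1 h
          have hpg : ¬(p : ℤ) ∣ g := fun h' => n0 (h'.trans hg1)
          rw [eX2] at d2
          exact (hp'.dvd_or_dvd d2).resolve_left hpg
        · obtain ⟨d0, d1, d2, n1, s2⟩ := f2 h
          have hpg : (p : ℤ) ∣ g := Int.natCast_dvd_natCast.2 (dvd_content3 d0 d1 d2)
          have hpg2 : ¬((p : ℤ) ^ 2 ∣ g) := fun h' => n1 (h'.trans hg2)
          rw [eX2] at s2
          exact dvd_of_sq_dvd_mul hp s2 hpg hpg2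
    · -- `p = 2 ∤ abc`
      have hp2 : p = 2 := by
        rcases hrel' with h | h | h | h
        · exact absurd h hpa
        · exact absurd h hpb
        · exact absurd h hpc
        · exact h
      subst hp2
      obtain ⟨_, f2⟩ := localWeight_facts_two (e₁ := e₁) (e₂ := e₂) hP hPc hpa hpb hpc v
      refine ⟨?_, fun h => absurd h hpa, fun h => absurd h hpb, fun h => absurd h hpc⟩
      rcases hvals with h | h | h
      · exact absurd h hw0
      · rw [h]; simp
      · rw [h]; obtain ⟨d0, d1, d2, -⟩ := f2 h
        exact Int.natCast_dvd_natCast.2 (dvd_content3 d0 d1 d2)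
  refine ⟨?_, ?_, ?_, ?_⟩
  · -- `∏ w_p ∣ g` (pairwise coprime factors)
    apply Int.natCast_dvd_natCast.1
    unfold intWeight
    push_cast
    refine Finset.prod_dvd_of_coprime ?_ fun p hp => (claim p hp).1
    intro p hp q hq hne
    have hpp := (hrelS p hp).1
    have hqp := (hrelS q hq).1
    change IsCoprime (w p : ℤ) (w q : ℤ)
    rcases hw1p p hp with h1 | h1
    · rw [h1, Nat.cast_one]; exact isCoprime_one_left
    rcases hw1p q hq with h2 | h2
    · rw [h2, Nat.cast_one]; exact isCoprime_one_right
    rw [h1, h2]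
    exact Nat.isCoprime_iff_coprime.2 ((Nat.coprime_primes hpp hqp).2 hne)
  · exact natCast_dvd_of_forall_prime (Squarefree.of_mul_left (Squarefree.of_mul_left hd))
      fun p hp hpa => (claim p ((mem_primeSet habc).2 ⟨hp, Or.inr (hpa.mul_right _ |>.mul_right _)⟩)).2.1 hpa
  · exact natCast_dvd_of_forall_prime (Squarefree.of_mul_right (Squarefree.of_mul_left hd))
      fun p hp hpb => (claim p ((mem_primeSet habc).2 ⟨hp, Or.inr ((hpb.mul_left _).mul_right _)⟩)).2.2.1 hpb
  · exact natCast_dvd_of_forall_prime (Squarefree.of_mul_right hd)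
      fun p hp hpc => (claim p ((mem_primeSet habc).2 ⟨hp, Or.inr (hpc.mul_left _)⟩)).2.2.2 hpc

end GlobalFacts

end Literature.NumberTheory.DiophantineGeometry
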